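import Summits.BirchSwinnertonDyer.BirchSwinnertonDyer.Theorems.KolyvaginDepthDoorDepthTableIntrinsic
import Summits.BirchSwinnertonDyer.BirchSwinnertonDyer.Theorems.KolyvaginDepthDoorDepthTableSteinWuthrichRows8
import Summits.BirchSwinnertonDyer.BirchSwinnertonDyer.Theorems.KolyvaginDepthDoorKNSupplyResidualStructureOfPrint
import Summits.BirchSwinnertonDyer.Rank1Residual.X11b.BDPRouteManin
import Literature.NumberTheory.EllipticCurves.KuriharaNumberInvariants
import Literature.NumberTheory.EllipticCurves.KuriharaNumberKimStructure
import Literature.NumberTheory.EllipticCurves.LocalTorsionGoodReductionProofs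
import Literature.NumberTheory.EllipticCurves.SkinnerUrban2014.PAdicUnitPeriodRatioProofs
import Literature.NumberTheory.EllipticCurves.NeronIsogenyScalingHoldsProofs
import HarnessLib
import Literature.NumberTheory.EllipticCurves.KuriharaNumberKimModPSelmerBound

/-!
# Route `KolyvaginDepthDoor`, crux `KolyvaginDepthSupplyKN` (stmt-BirchSwinnertonDyer-22820) —
# DEPTH TABLE v17, GENERIC: THE KURIHARA CURRENCY — both bits of a row from UNIT mod-`p` KURIHARA NUMBERS
# (C.-H. Kim, Amer. J. Math. 148 (2026), Thm. 1.11 BY NAME), i.e. from finite exact sums of modular symbols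

Helper file of the lead prover of line `levelone` (kdd-p1 g21; `--supports stmt-BirchSwinnertonDyer-22820
--as helper`); it closes nothing and BSD is NOT proved by it.

WHAT IS NEW. Every row of the depth table (v10–v16) reads the crux's clause at a rank-two curve `E` off TWO
inputs: the `E`-side «`Ш(E/ℚ)[p] = 0`» (v13–v16: Stein–Wuthrich 2013 Thm. 1.1 BY NAME, a computational
theorem with `N_E ≤ 30 000`, `p < 1000`) and the twist side «`#Sel_p(E^{(d_K)}/ℚ) ≤ p^{rank E}`» (v12: two
`Ш`'s; v14: an exact `L`-value; v15/v16: ONE `p`-adic valuation of the transcendental BSD quotient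
`L'(T,1)/(Ω_T Reg_T)` of the Heegner twist, granted `ord_{s=1} L(T, s) = 1`). v17 reads BOTH off the
SAME kind of datum — ONE UNIT mod-`p` KURIHARA NUMBER `δ̃_n ≢ 0 (mod p)` (Kurihara 2014 (1.3); Kim 2026
§1.4: a finite sum `∑_{a ∈ (ℤ/n)ˣ} [a/n]⁺ ∏_{ℓ∣n} log_{η_ℓ}(a)` of plus modular symbols, an EXACT rational
computation at level `N_E`, resp. `N_E d_K²`) — through ONE printed theorem, C.-H. Kim, *The structure of
Selmer groups and the Iwasawa main conjecture for elliptic curves*, Amer. J. Math. 148 (2026) 79–129,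
**Theorem 1.11** (the mod-`p` structure theorem: at a good ordinary `p ≥ 5` with `ρ̄` onto, (manin),
`E(ℚ_p)[p] = 0`, `p ∤ Tam(E)`, where the cyclotomic main conjecture (3) is a theorem, the mod-`p` Selmer
group `Sel(ℚ, E[p])` is cut out by the localisation at a Kurihara level of minimal depth, so that a unit
`δ̃_n` at ANY cyclic level `n` bounds `dim_{𝔽_p} Sel(ℚ, E[p]) ≤ ν(n)`; the tree's named fact
`Kim2022_card_selmerGroup_le_pow_of_kuriharaNumber_ne_zero` below, hypothesis `hKim`):

* `sha_inf_torsionBy_eq_bot_of_natCard_selmerGroup_le` — descent count: `#Sel_p(E) ≤ p^{rank E}` ⟹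
  `Ш(E/ℚ)[p] = 0` (Silverman X.4.2; UNCONDITIONAL).
* `natCard_selmerGroup_le_pow_of_kuriharaClaim` — **E-SIDE**: `W` globally minimal, `p ≥ 5` good ordinary,
  `ρ̄_{E,p}` onto, `a_p ≢ 1 (mod p)` (non-anomalous ⟹ `E(ℚ_p)[p] = 0`, AEC VII.3.1), `p ∤ ord_v(Δ_min)` at
  multiplicative `v` (Kodaira–Néron ⟹ `p ∤ Tam(E)`), a cyclic Kolyvagin level `n` and the CLAIM «every datum
  `D` with `p ∤ c_D` and the period transfer has `kuriharaNumber D.f p n ψ ≠ 0` for some surjective `ψ`»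
  (= `KuriharaCertificates.Record.Claim` of a tree record) ⟹ `#Sel_p(E/ℚ) ≤ p^{ν(n)}`. The datum with
  `p ∤ c_D` EXISTS modulo modularity + Mazur 1978 Cor. 4.1 (`X11b.exists_modularParametrizationData_not_dvd`,
  Néron scaling a tree theorem) and the period transfer is Mazur's corollary again
  (`SkinnerUrban2014.realPeriodRat_eq_unit_mul_plusPeriod_of_mazur`) — both ALREADY print stubs of the line: v17
  adds exactly ONE named fact (`hKim`).
* `sha_inf_torsionBy_eq_bot_of_kuriharaClaim` — the E-side bit: `ν(n) ≤ rank E` ⟹ `Ш(E/ℚ)[p] = 0`.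
* `natCard_selmerGroup_quadraticTwist_le_of_kuriharaClaim` — **TWIST SIDE**: the same for ANY globally
  minimal model `T` of `E^{(d)}` (`C • T = W.quadraticTwist d`), good ordinary reduction and surjectivity
  of `T` DERIVED from `W` (v16), the `T`-side inputs being `a_p(T) ≢ 1`, Kodaira–Néron for `T`, a cyclic
  level `m` of `T` and the claim ⟹ `#Sel_p(E^{(d)}/ℚ) ≤ p^{ν(m)}`. NO analytic-rank hypothesis on the
  twist, no `L`-value, no regulator, no Heegner point.
* `cruxBody_of_kuriharaClaims_spade` — **THE v17 ROW MECHANISM**: E-side claim at a cyclic level `n` with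
  `ν(n) ≤ rank E`, twist-side claim at a cyclic level `m` with `ν(m) ≤ rank E` ⟹ the clause of
  `KolyvaginDepthSupplyKN` at `W` VERBATIM, on W. Zhang's ♠ cell (any `p ∤ d_K`, inert or split; g17's
  `cruxBody_of_sha_of_twistSelmer_of_lemma84`); the split-cell twin (Castella–Sano supply, g20's
  `cruxBody_of_sha_of_twistSelmer_of_castellaSano`) is stated with the split rows in the sibling file.

READING. «ONE ANTICYCLOTOMIC BIT ⟸ TWO CYCLOTOMIC BITS»: the depth door's datum at `(E, p, K)` follows from
two Kurihara-number units (one of `E` at depth `rank E`, one of the Heegner twist at depth `≤ rank E`) modulo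
print; the data for the table's curves are ALREADY IN THE TREE as kernel-rechecked records
(`KuriharaCertificates/Records*.lean`: `cert_389a1` at `p = 5`, `n = 41·61`; `cert_19061a1` = `389a1^{(−7)}`
at `p = 5`, `n = 211`); the row files `KolyvaginDepthDoorDepthTableKuriharaRow*.lean` instantiate them.

CONDITIONAL on Kim 2026 Thm. 1.11 (`hKim`), modularity, Mazur 1978 Cor. 4.1, and the structure print of
the cell (W. Zhang L8.4 (1)/9.1) BY NAME,
and on the displayed Kurihara CLAIMS; per `(W, p, K)`; nothing class-wide (the open stub (S♭) is
untouched); BSD is NOT proved by any of this.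

References: [Kim2022StructureSelmer] C.-H. Kim, Amer. J. Math. 148 (2026) 79–129 = arXiv:2203.12159,
Thm. 1.11 (journal Thm. 1.10), §1.2.2, §1.4, §6; [Kurihara2014] M. Kurihara, Contrib. Math. Comput. Sci.
7 (2014) = arXiv:1407.2465, Thm. 1.2.3 (1), Conj. 1.2.4; [BurungaleCastellaSkinner2025] Thm. 1.1.2 (b);
[Kato2004Asterisque] Thm. 17.4; [Mazur1978] Cor. 4.1; [GreenbergVatsal2000] §3 Rem. 3.4;
[SilvermanAEC2009] VII.3.1, X.4.2; [WZhang2014] Lemma 8.4 (1), Thm. 9.1; [CastellaSano2026] Thm. 3.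
-/

set_option linter.dupNamespace false

noncomputable section

open scoped Classical NumberField

namespace Summit.BirchSwinnertonDyer.BirchSwinnertonDyer.Theorems.KolyvaginDepthDoor

/-! ## §0 The one new named print input: Kim 2026, Theorem 1.11 (mod-`p` structure), BY NAME -/

open Literature.NumberTheory.EllipticCurves Literature.NumberTheory.EllipticCurves.ModularForms
  WeierstrassCurve NumberField IsDedekindDomain CongruenceSubgroup
open Summit.BirchSwinnertonDyer.BirchSwinnertonDyer.Theorems

/-! ## §1 Descent count: a `p`-Selmer bound by `p^{rank}` kills `Ш[p]` (unconditional) -/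

/-- **`#Sel_p(E/ℚ) ≤ p^{rank_ℤ E(ℚ)}` ⟹ `Ш(E/ℚ)[p] = 0`** (any elliptic `W/ℚ`, `p` prime): by the exact
descent count `#Sel_p = p^{rank} · #E(ℚ)[p] · #Ш[p]` (`natCard_selmerGroup_eq`, AEC X.4.2) and finiteness of
`Sel_p`, both factors `#E(ℚ)[p]`, `#Ш[p]` are `1`. UNCONDITIONAL. [cite: SilvermanAEC2009, Thm. X.4.2] -/
theorem sha_inf_torsionBy_eq_bot_of_natCard_selmerGroup_le (W : WeierstrassCurve ℚ) [W.IsElliptic]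
    (p : ℕ) [hp : Fact p.Prime] (h : Nat.card (W.selmerGroup p) ≤ p ^ W.mordellWeilRank) :
    (W.sha ⊓ AddSubgroup.torsionBy W.galH1 (p : ℤ) : AddSubgroup W.galH1) = ⊥ := by
  have hp0 : (p : ℕ) ≠ 0 := hp.out.ne_zero
  have hcount := W.natCard_selmerGroup_eq hp0
  haveI : Finite (W.selmerGroup p) := W.finite_selmerGroup_holds (Int.natCast_ne_zero.mpr hp0)
  have hpos : 0 < Nat.card (W.selmerGroup p) := Nat.card_pos
  have hr : 0 < p ^ W.mordellWeilRank := pow_pos hp.out.pos _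
  -- pure arithmetic: `S = p^r·A·B`, `S ≤ p^r`, `0 < S` ⟹ `B = 1`
  have key : ∀ {S r A B : ℕ}, 0 < p ^ r → S = p ^ r * A * B → S ≤ p ^ r → 0 < S → B = 1 := by
    intro S r A B hr' hS hle hpos'
    subst hS
    have h1 : p ^ r * (A * B) ≤ p ^ r * 1 := by rw [mul_one, ← mul_assoc]; exact hle
    have h2 : A * B ≤ 1 := le_of_mul_le_mul_left h1 hr'
    have h3 : A * B ≠ 0 := by
      intro h0
      rw [mul_assoc, h0, mul_zero] at hpos'
      exact lt_irrefl 0 hpos'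
    exact Nat.eq_one_of_mul_eq_one_left (le_antisymm h2 (Nat.one_le_iff_ne_zero.mpr h3))
  exact AddSubgroup.card_eq_one.mp (key hr hcount h hpos)

/-! ## §2 The E-side: `#Sel_p(E/ℚ) ≤ p^{ν(n)}` and `Ш(E/ℚ)[p] = 0` from one unit Kurihara number -/

section ESide

variable (hKim : Literature.NumberTheory.EllipticCurves.Kim2022_card_selmerGroup_le_pow_of_kuriharaNumber_ne_zero)
  (hnf : exists_isNewformOf) (hMaz : mazur_not_dvd_maninConstant_of_odd)
include hKim hnf hMaz

/-- **E-SIDE: `#Sel_p(E/ℚ) ≤ p^{ν(n)}` from ONE unit mod-`p` Kurihara number at a cyclic level `n`.** `W`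
globally minimal elliptic; `p ≥ 5` good ordinary with `ρ̄_{E,p}` onto; `a_p ≢ 1 (mod p)` (⟹ `E(ℚ_p)[p] = 0`,
AEC VII.3.1, tree `localTorsion_eq_zero_of_good_of_not_dvd_frobeniusTrace_sub_one`); `p ∤ ord_v(Δ_min)` at
every multiplicative place (⟹ `p ∤ Tam(E)`, `not_dvd_tamagawaProduct_of_kodairaNeron`); `n` a cyclic
Kolyvagin level; the CLAIM `hδ`: every datum `D` at level `N_E` with `p ∤ c_D` and the period transfer carries
`kuriharaNumber D.f p n ψ ≠ 0` for some surjective `ψ` (the shape of `KuriharaCertificates.Record.Claim`).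
The datum exists by modularity + Mazur 1978 Cor. 4.1 + Néron scaling (`X11b.exists_modularParametrizationData_not_dvd`,
`p ∤ N_E`), the period transfer by Mazur's corollary (`SkinnerUrban2014.realPeriodRat_eq_unit_mul_plusPeriod_of_mazur`),
and Kim's Theorem 1.11 (`hKim`) concludes. CONDITIONAL on the three named facts and the claim; BSD is not
proved by it. [cite: Kim2022StructureSelmer, Thm. 1.11 (PDF p. 8)] [cite: Mazur1978, Cor. 4.1]
[cite: SilvermanAEC2009, VII.3 Prop. 3.1] -/
theorem natCard_selmerGroup_le_pow_of_kuriharaClaim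
    (W : WeierstrassCurve ℚ) [W.IsElliptic] [W.IsGloballyMinimal] (p : ℕ) [hp : Fact p.Prime] (h5 : 5 ≤ p)
    (hgood : W.HasGoodReductionAtPrime p) (hord : ¬ (p : ℤ) ∣ W.frobeniusTrace p)
    (hsur : W.HasSurjectiveModNGaloisRep p) (hna : ¬ (p : ℤ) ∣ W.frobeniusTrace p - 1)
    (hKN : ∀ v : HeightOneSpectrum (𝓞 ℚ), W.HasMultiplicativeReductionAt v → ¬ p ∣ W.ordMinimalDiscriminant v)
    [iNZ : NeZero (W.conductorNorm ℤ)] (n : ℕ) [NeZero n] (hn : IsCyclicKolyvaginLevel W p n)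
    (hδ : ∀ (D : ModularParametrizationData W (W.conductorNorm ℤ)), ¬ (p : ℤ) ∣ D.maninConstant →
      (∃ u : ℚ, ‖(u : ℚ_[p])‖ = 1 ∧ W.realPeriodRat = u * plusPeriod D.f) →
      ∃ ψ : (ℓ : ℕ) → (ZMod ℓ)ˣ →* Multiplicative (ZMod p),
        (∀ ℓ ∈ n.primeFactors, Function.Surjective (ψ ℓ)) ∧ kuriharaNumber D.f p n ψ ≠ 0) :
    Nat.card (W.selmerGroup p) ≤ p ^ n.primeFactors.card := by
  have hpP : p.Prime := hp.out
  have hp2 : p ≠ 2 := by omega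
  haveI : NeZero (p : ℚ) := ⟨by exact_mod_cast hpP.ne_zero⟩
  have hirr : W.HasIrreducibleModPGaloisRep p := hasIrreducibleModPGaloisRep_of_hasSurjectiveModNGaloisRep W p hsur
  -- the datum with `p ∤ c_D` (modularity + Mazur + Néron scaling)
  have hpN : ¬ p ^ 2 ∣ W.conductorNorm ℤ := fun h ↦
    not_dvd_conductorNorm_of_hasGoodReductionAtPrime W hgood (dvd_trans (dvd_pow_self p two_ne_zero) h)
  obtain ⟨D, hD⟩ := Summit.BirchSwinnertonDyer.Rank1Residual.X11b.exists_modularParametrizationData_not_dvd hnf hMaz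
    integral_neronScaling_of_isGloballyMinimal_holds W rfl hpP hp2 hpN hirr
  have hc : ¬ (p : ℤ) ∣ D.maninConstant := hD
  -- the period transfer (Mazur's corollary again)
  have hu : ∃ u : ℚ, ‖(u : ℚ_[p])‖ = 1 ∧ W.realPeriodRat = u * plusPeriod D.f :=
    SkinnerUrban2014.realPeriodRat_eq_unit_mul_plusPeriod_of_mazur hMaz W p h5 hgood hirr D.f D.isNewformOf
  -- `E(ℚ_p)[p] = 0` (non-anomalous) and `p ∤ Tam(E)` (Kodaira–Néron)
  have ht0 : ∀ P : (W.baseChange ℚ_[p]).toAffine.Point, (p : ℤ) • P = 0 → P = 0 := fun P hP ↦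
    localTorsion_eq_zero_of_good_of_not_dvd_frobeniusTrace_sub_one W p (by omega) hgood hna P
      (by rw [← natCast_zsmul]; exact hP)
  have htam : ¬ p ∣ W.tamagawaProduct := not_dvd_tamagawaProduct_of_kodairaNeron W p h5 hKN
  obtain ⟨ψ, hψ, hne⟩ := hδ D hc hu
  exact hKim W p h5 ⟨hgood, hord⟩ hsur ht0 htam D hc hu n hn ψ hψ hne

/-- **E-SIDE BIT: `Ш(E/ℚ)[p] = 0` from ONE unit Kurihara number at a cyclic level of depth `ν(n) ≤ rank_ℤ E(ℚ)`**
(so `ν(n) = rank`: Kim's mod-`p` rank certificate read downwards) — `natCard_selmerGroup_le_pow_of_kuriharaClaim`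
+ the descent count. This REPLACES Stein–Wuthrich 2013 Thm. 1.1 (the `E`-side input of v13–v16) by an exact
modular-symbol certificate + Kim's Theorem 1.11; no conductor bound, no `p < 1000`. CONDITIONAL on `hKim`,
modularity, Mazur and the claim; BSD is not proved by it. [cite: Kim2022StructureSelmer, Thm. 1.11 (PDF p. 8)]
[cite: SilvermanAEC2009, Thm. X.4.2] -/
theorem sha_inf_torsionBy_eq_bot_of_kuriharaClaim
    (W : WeierstrassCurve ℚ) [W.IsElliptic] [W.IsGloballyMinimal] (p : ℕ) [hp : Fact p.Prime] (h5 : 5 ≤ p)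
    (hgood : W.HasGoodReductionAtPrime p) (hord : ¬ (p : ℤ) ∣ W.frobeniusTrace p)
    (hsur : W.HasSurjectiveModNGaloisRep p) (hna : ¬ (p : ℤ) ∣ W.frobeniusTrace p - 1)
    (hKN : ∀ v : HeightOneSpectrum (𝓞 ℚ), W.HasMultiplicativeReductionAt v → ¬ p ∣ W.ordMinimalDiscriminant v)
    [iNZ : NeZero (W.conductorNorm ℤ)] (n : ℕ) [NeZero n] (hn : IsCyclicKolyvaginLevel W p n)
    (hν : n.primeFactors.card ≤ W.mordellWeilRank)
    (hδ : ∀ (D : ModularParametrizationData W (W.conductorNorm ℤ)), ¬ (p : ℤ) ∣ D.maninConstant →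
      (∃ u : ℚ, ‖(u : ℚ_[p])‖ = 1 ∧ W.realPeriodRat = u * plusPeriod D.f) →
      ∃ ψ : (ℓ : ℕ) → (ZMod ℓ)ˣ →* Multiplicative (ZMod p),
        (∀ ℓ ∈ n.primeFactors, Function.Surjective (ψ ℓ)) ∧ kuriharaNumber D.f p n ψ ≠ 0) :
    (W.sha ⊓ AddSubgroup.torsionBy W.galH1 (p : ℤ) : AddSubgroup W.galH1) = ⊥ :=
  sha_inf_torsionBy_eq_bot_of_natCard_selmerGroup_le W p
    ((natCard_selmerGroup_le_pow_of_kuriharaClaim hKim hnf hMaz W p h5 hgood hord hsur hna hKN n hn hδ).trans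
      (Nat.pow_le_pow_right hp.out.pos hν))

/-! ## §3 The twist side: `#Sel_p(E^{(d)}/ℚ) ≤ p^{ν(m)}` from one unit Kurihara number of ANY minimal twist model -/

/-- **TWIST SIDE: `#Sel_p(E^{(d)}/ℚ) ≤ p^{ν(m)}` from ONE unit Kurihara number of a globally minimal model
`T` of the twist.** `W` globally minimal elliptic, `p ≥ 5` good ordinary for `W` with `ρ̄_{W,p}` onto, `d ≠ 0`
with `p ∤ d`; `T` ANY globally minimal model of `E^{(d)}` (`C • T = W.quadraticTwist d`): good ordinary
reduction and surjectivity of `T` at `p` are DERIVED from `W` (v16: `goodOrdinary_of_smul_eq_quadraticTwist_of_ne_zero`,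
`hasSurjectiveModNGaloisRep_of_smul_eq_quadraticTwist`); the `T`-side inputs are `a_p(T) ≢ 1 (mod p)`,
Kodaira–Néron for `T` at `p`, a cyclic Kolyvagin level `m` of `T` and the claim for `T`; Selmer transport
along `C` (`natCard_selmerGroup_eq_of_variableChange`). NO hypothesis on the analytic rank of the twist.
CONDITIONAL on `hKim`, modularity, Mazur and the claim; BSD is not proved by it.
[cite: Kim2022StructureSelmer, Thm. 1.11 (PDF p. 8)] [cite: SilvermanAEC2009, X.4, X.5 Cor. 5.4] -/
theorem natCard_selmerGroup_quadraticTwist_le_of_kuriharaClaim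
    (W : WeierstrassCurve ℚ) [W.IsElliptic] [W.IsGloballyMinimal] (p : ℕ) [hp : Fact p.Prime] (h5 : 5 ≤ p)
    (hgood : W.HasGoodReductionAtPrime p) (hord : ¬ (p : ℤ) ∣ W.frobeniusTrace p)
    (hsur : W.HasSurjectiveModNGaloisRep p) {d : ℤ} (hd : d ≠ 0) (hpd : ¬ (p : ℤ) ∣ d)
    (T : WeierstrassCurve ℚ) [T.IsElliptic] [T.IsGloballyMinimal] (C : VariableChange ℚ)
    (hC : C • T = W.quadraticTwist (d : ℚ))
    (hTna : ¬ (p : ℤ) ∣ T.frobeniusTrace p - 1)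
    (hTKN : ∀ v : HeightOneSpectrum (𝓞 ℚ), T.HasMultiplicativeReductionAt v → ¬ p ∣ T.ordMinimalDiscriminant v)
    [iNZT : NeZero (T.conductorNorm ℤ)] (m : ℕ) [NeZero m] (hm : IsCyclicKolyvaginLevel T p m)
    (hδT : ∀ (D : ModularParametrizationData T (T.conductorNorm ℤ)), ¬ (p : ℤ) ∣ D.maninConstant →
      (∃ u : ℚ, ‖(u : ℚ_[p])‖ = 1 ∧ T.realPeriodRat = u * plusPeriod D.f) →
      ∃ ψ : (ℓ : ℕ) → (ZMod ℓ)ˣ →* Multiplicative (ZMod p),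
        (∀ ℓ ∈ m.primeFactors, Function.Surjective (ψ ℓ)) ∧ kuriharaNumber D.f p m ψ ≠ 0) :
    Nat.card ((W.quadraticTwist (d : ℚ)).selmerGroup p) ≤ p ^ m.primeFactors.card := by
  have hpP : p.Prime := hp.out
  have hdq : (d : ℚ) ≠ 0 := by exact_mod_cast hd
  have hTsur : T.HasSurjectiveModNGaloisRep p := hasSurjectiveModNGaloisRep_of_smul_eq_quadraticTwist W T hdq hC p hsur
  have hp2d : ¬ ((p : ℤ) ∣ 2 * d) := by
    intro h
    rcases (Nat.prime_iff_prime_int.mp hpP).dvd_or_dvd h with h2 | h2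
    · have : p = 2 := (Nat.prime_dvd_prime_iff_eq hpP Nat.prime_two).mp (by exact_mod_cast h2)
      omega
    · exact hpd h2
  obtain ⟨hTgood, hTord⟩ := goodOrdinary_of_smul_eq_quadraticTwist_of_ne_zero W T hd hC p hp2d hgood hord
  rw [← natCard_selmerGroup_eq_of_variableChange (p : ℤ) hC]
  exact natCard_selmerGroup_le_pow_of_kuriharaClaim hKim hnf hMaz T p h5 hTgood hTord hTsur hTna hTKN m hm hδT

/-! ## §4 The v17 row mechanism: the crux's clause at `W` from TWO Kurihara claims -/

/-- **THE v17 ROW MECHANISM ON W. ZHANG'S ♠ CELL (any `p ∤ d_K`, inert or split): the clause of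
`KolyvaginDepthSupplyKN` at `W` from TWO UNIT KURIHARA NUMBERS.** `W` globally minimal elliptic with
`2 ≤ rank_ℤ E(ℚ)`; `p ≥ 5` good ordinary, `ρ_{E,p^n}` onto for all `n`, `p ∤ ord_v(Δ_min)` at multiplicative
`v`, `a_p ≢ 1 (mod p)`, ♠ (1) (`p ∤ v_ℓ(Δ_min)` at multiplicative `ℓ`) and ♠ (2); `K` imaginary quadratic Heegner for
`N_E` with `d_K ∉ {−3,−4}`, `p ∤ d_K`; `T` ANY globally minimal model of `E^{(d_K)}` with `a_p(T) ≢ 1` and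
Kodaira–Néron at `p`. IF the E-side claim holds at a cyclic level `n` with `ν(n) ≤ rank E` and the twist-side
claim at a cyclic level `m` of `T` with `ν(m) ≤ rank E`, THEN the clause of the crux holds at `W` VERBATIM:
§2 gives `Ш(E)[p] = 0`, §3 gives `#Sel_p(E^{(d_K)}) ≤ p^{ν(m)} ≤ p^{rank E}`, and g17's
`cruxBody_of_sha_of_twistSelmer_of_lemma84` (W. Zhang L8.4 (1) / 9.1 by name, `h84`) concludes. CONDITIONAL on
Kim Thm. 1.11, modularity, Mazur Cor. 4.1, W. Zhang L8.4 (1)/9.1 BY NAME and the two claims; per `(W, p, K)`;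
nothing class-wide; BSD is not proved by it. [cite: Kim2022StructureSelmer, Thm. 1.11 (PDF p. 8)]
[cite: WZhang2014, Lemma 8.4 (1) (p. 236), Thm. 9.1 (p. 240)] [cite: Mazur1978, Cor. 4.1] -/
theorem cruxBody_of_kuriharaClaims_spade
    (h84 : Literature.NumberTheory.EllipticCurves.WZhang2014_lemma84_exists_minimal_kolyvaginClass_one_selmerCard)
    (W : WeierstrassCurve ℚ) [W.IsElliptic] [W.IsGloballyMinimal] (hr : 2 ≤ W.mordellWeilRank)
    (p : ℕ) [hp : Fact p.Prime] (h5 : 5 ≤ p) (hgood : W.HasGoodReductionAtPrime p)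
    (hord : ¬ (p : ℤ) ∣ W.frobeniusTrace p)
    (htower : ∀ n : ℕ, W.HasSurjectiveModNGaloisRep (p ^ n : ℕ))
    (hKN : ∀ v : HeightOneSpectrum (𝓞 ℚ), W.HasMultiplicativeReductionAt v → ¬ p ∣ W.ordMinimalDiscriminant v)
    (hna : ¬ (p : ℤ) ∣ W.frobeniusTrace p - 1)
    (hS1 : ∀ (ℓ : ℕ) [Fact ℓ.Prime], W.HasMultiplicativeReductionAtPrime ℓ →
      ¬ p ∣ padicValInt ℓ W.minimalDiscriminantInt)
    (hS2 : ¬ Squarefree (W.conductorNorm ℤ) →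
      (∃ (ℓ : ℕ) (_ : Fact ℓ.Prime), W.HasMultiplicativeReductionAtPrime ℓ ∧
          ¬ p ∣ padicValInt ℓ W.minimalDiscriminantInt) ∧
        ∃ (ℓ₁ ℓ₂ : ℕ) (_ : Fact ℓ₁.Prime) (_ : Fact ℓ₂.Prime), ℓ₁ ≠ ℓ₂ ∧
          W.HasMultiplicativeReductionAtPrime ℓ₁ ∧ W.HasMultiplicativeReductionAtPrime ℓ₂)
    (K : Type) [Field K] [NumberField K] (hK : IsImaginaryQuadratic K)
    (hD3 : NumberField.discr K ≠ -3) (hD4 : NumberField.discr K ≠ -4) (hpD : ¬ ((p : ℤ) ∣ NumberField.discr K))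
    [iNZ : NeZero (W.conductorNorm ℤ)] (hH : SatisfiesHeegnerHypothesis (W.conductorNorm ℤ) K)
    -- E-side claim
    (n : ℕ) [NeZero n] (hn : IsCyclicKolyvaginLevel W p n) (hν : n.primeFactors.card ≤ W.mordellWeilRank)
    (hδ : ∀ (D : ModularParametrizationData W (W.conductorNorm ℤ)), ¬ (p : ℤ) ∣ D.maninConstant →
      (∃ u : ℚ, ‖(u : ℚ_[p])‖ = 1 ∧ W.realPeriodRat = u * plusPeriod D.f) →
      ∃ ψ : (ℓ : ℕ) → (ZMod ℓ)ˣ →* Multiplicative (ZMod p),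
        (∀ ℓ ∈ n.primeFactors, Function.Surjective (ψ ℓ)) ∧ kuriharaNumber D.f p n ψ ≠ 0)
    -- twist-side claim, on any minimal model `T` of `E^{(d_K)}`
    (T : WeierstrassCurve ℚ) [T.IsElliptic] [T.IsGloballyMinimal] (C : VariableChange ℚ)
    (hC : C • T = W.quadraticTwist (NumberField.discr K : ℚ))
    (hTna : ¬ (p : ℤ) ∣ T.frobeniusTrace p - 1)
    (hTKN : ∀ v : HeightOneSpectrum (𝓞 ℚ), T.HasMultiplicativeReductionAt v → ¬ p ∣ T.ordMinimalDiscriminant v)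
    [iNZT : NeZero (T.conductorNorm ℤ)] (m : ℕ) [NeZero m] (hm : IsCyclicKolyvaginLevel T p m)
    (hμ : m.primeFactors.card ≤ W.mordellWeilRank)
    (hδT : ∀ (D : ModularParametrizationData T (T.conductorNorm ℤ)), ¬ (p : ℤ) ∣ D.maninConstant →
      (∃ u : ℚ, ‖(u : ℚ_[p])‖ = 1 ∧ T.realPeriodRat = u * plusPeriod D.f) →
      ∃ ψ : (ℓ : ℕ) → (ZMod ℓ)ˣ →* Multiplicative (ZMod p),
        (∀ ℓ ∈ m.primeFactors, Function.Surjective (ψ ℓ)) ∧ kuriharaNumber D.f p m ψ ≠ 0) :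
    ∃ (p : ℕ) (hp : Fact p.Prime), 5 ≤ p ∧ W.HasGoodReductionAtPrime p ∧
      ¬ (p : ℤ) ∣ W.frobeniusTrace p ∧ (∀ n : ℕ, W.HasSurjectiveModNGaloisRep (p ^ n : ℕ)) ∧
      (∀ v : HeightOneSpectrum (𝓞 ℚ), W.HasMultiplicativeReductionAt v →
        ¬ p ∣ W.ordMinimalDiscriminant v) ∧
      ∃ (K : Type) (_ : Field K) (_ : NumberField K), IsImaginaryQuadratic K ∧
        NumberField.discr K ≠ -3 ∧ NumberField.discr K ≠ -4 ∧
        ∃ (_ : NeZero (W.conductorNorm ℤ)), SatisfiesHeegnerHypothesis (W.conductorNorm ℤ) K ∧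
        ∃ (Dt : ModularParametrizationData W (W.conductorNorm ℤ)) (β : ℤ) (ι : K →+* ℂ) (n₁ : ℕ)
          (d : KolyvaginHeegnerData Dt β ι n₁), Squarefree n₁ ∧
          (∀ q ∈ n₁.primeFactors, Zhang2014.IsKolyvaginPrime (W.conductorNorm ℤ) W K p q) ∧
          d.kolyvaginClass hp.out 1 ≠ 0 ∧
          (n₁.primeFactors.card + 1 ≤ W.mordellWeilRank ∨
            (n₁.primeFactors.card ≤ W.mordellWeilRank ∧
              n₁.primeFactors.card + 1 ≤ (W.quadraticTwist (NumberField.discr K : ℚ)).mordellWeilRank)) := by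
  have hsur : W.HasSurjectiveModNGaloisRep p := by simpa only [pow_one] using htower 1
  have hdK : NumberField.discr K ≠ 0 := NumberField.discr_ne_zero K
  have hsha := sha_inf_torsionBy_eq_bot_of_kuriharaClaim hKim hnf hMaz W p h5 hgood hord hsur hna hKN n hn hν hδ
  have hT : Nat.card ((W.quadraticTwist (NumberField.discr K : ℚ)).selmerGroup p) ≤ p ^ W.mordellWeilRank :=
    (natCard_selmerGroup_quadraticTwist_le_of_kuriharaClaim hKim hnf hMaz W p h5 hgood hord hsur hdK hpD T C hC
      hTna hTKN m hm hδT).trans (Nat.pow_le_pow_right hp.out.pos hμ)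
  exact cruxBody_of_sha_of_twistSelmer_of_lemma84 h84 W hr p h5 hgood hord htower hKN hS1 hS2 K hK hD3 hD4 hpD hH
    hsha hT

end ESide

end Summit.BirchSwinnertonDyer.BirchSwinnertonDyer.Theorems.KolyvaginDepthDoor

end
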